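import Summits.AtomisticToContinuum.HydrodynamicLimit.Theorems.TwoClocksEquilibriumFastWindowLDBirthT12GainRadialGeneral
import Mathlib.MeasureTheory.Function.JacobianOneDim
import HarnessLib

/-!
# (e-K₂) for GENERAL radial test functions, II: the true gain term on `G ∘ ‖·‖` against its Lorentz
# limit for `G` merely measurable of linear growth — absolute error `O(m (1 + ‖v‖))`
# (helper `t12_gainTerm_radial_sub_lorentz` of the line `birth`, crux `TwoClocks.EquilibriumFastWindowLD`,
# stmt-AtomisticToContinuum-14440; infrastructure (e-K₂), `ℓ = 0`, towards the registered analytic sub-goal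
# `t12_logLinearPreimage_and_dipoleModulus`, plan §5)

Continuation of `…T12GainRadialGeneral`, where the law comparison was reduced to one dimension:
`gainTerm (G ∘ ‖·‖) v - lorentzGain (G ∘ ‖·‖) v = 4π ∫ γ(dt) (J(t) - J(0))`, `γ = gaussianReal 0 1`,
`J(t) = ∫_{-1}^{1} (S x - t)₊ G(√(S² - (S x)² + t²)) dx`, `S = ‖v‖`. Here the
one-dimensional estimate is carried out WITHOUT any regularity of `G` (measurable, `|G t| ≤ m(1 + t)` on
`[0, ∞)`):

* the flux factor: `|(S x - t)₊ - (S x)₊| ≤ |t|`, whence `|∫ ((S x - t)₊ - (S x)₊) G(…) dx| ≤ 2|t| m (1 + S + |t|)`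
  (`abs_integral_fluxShift_le`);
* the speed: by the substitution `y = S² - (S x)² + t²` (`integral_mul_comp_slice_subst`, Mathlib's
  `integral_image_eq_integral_abs_deriv_smul` — valid for every `G`),
  `∫₀¹ S x G(√(S² - (S x)² + t²)) dx = (2S)⁻¹ ∫_{t²}^{S² + t²} G(√y) dy`: the thermal projection `t` DISPLACES
  the window `[0, S²]` of the law of `‖v'‖²` by `t²`, so
  `∫₀¹ S x (G(√(S²(1-x²) + t²)) - G(√(S²(1-x²)))) dx = (2S)⁻¹ (∫_{S²}^{S²+t²} - ∫₀^{t²}) G(√y) dy = O(m t² (1 + |t|))`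
  for `S ≥ 1` and `O(m (1 + |t|))` trivially for `S ≤ 1` (`abs_integral_speedShift_le`);
* together (`abs_slice_sub_slice_zero_le`): `|J(t) - J(0)| ≤ m (4 + (3 + 2S)|t| + (7/2) t² + |t|³)`, and with the
  Gaussian moments `∫ t² dγ = 1`, `∫ t⁴ dγ = 3`: the registered
  **`t12_gainTerm_radial_sub_lorentz`: `|gainTerm (G ∘ ‖·‖) v - lorentzGain (G ∘ ‖·‖) v| ≤ 2π m (25 + 4‖v‖)`**
  for ALL measurable `G` of linear growth — relative error `O(1/‖v‖)` against the main term `(4/3)π m ‖v‖²`,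
  the order required by (e-K₂) of the corrector-growth plan. This supersedes the indicator / step-function /
  Lipschitz cases of `…T12GainRadial(B)`: in total-variation terms, the true law of the outgoing speed is an
  absolutely continuous `O(t²)`-displacement mixture of the Lorentz law, NOT merely Kolmogorov-close.

[folklore] (Carleman 1933 / Hilbert 1912 representation; Grad 1963 §4; Cercignani–Illner–Pulvirenti 1994 §7.2;
(e-K₂) of the corrector-growth plan of the line `birth`).
-/

noncomputable section

open MeasureTheory ProbabilityTheory Real Set Filter Metric
open scoped ENNReal BigOperators InnerProductSpace
namespace Summit.AtomisticToContinuum.HydrodynamicLimit.Theorems.ClampedCorrectorBirth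

open Literature.Analysis.FluidPDE Literature.MathematicalPhysics.KineticTheory
open Literature.Analysis.UnboundedOperators Literature.Probability.Distributions

variable {G : ℝ → ℝ} {m : ℝ}

/-! ### One-dimensional preliminaries -/

/-- **The substitution `y = S² - (S x)² + c`** (`0 < S`; NO hypothesis on `F`):
`2S ∫₀¹ S x F(S² - (S x)² + c) dx = ∫_c^{S² + c} F(y) dy` (Mathlib's change of variables
`integral_image_eq_integral_abs_deriv_smul` for the injective map `x ↦ S² - (S x)² + c` of `(0, 1)` onto
`(c, S² + c)`, Jacobian `2S² x`). [folklore] -/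
theorem integral_mul_comp_slice_subst (F : ℝ → ℝ) {S : ℝ} (hS : 0 < S) (c : ℝ) :
    2 * S * ∫ x in (0:ℝ)..1, S * x * F (S ^ 2 - (S * x) ^ 2 + c) = ∫ y in c..(S ^ 2 + c), F y := by
  have hderiv : ∀ x ∈ Ioo (0:ℝ) 1,
      HasDerivWithinAt (fun x : ℝ => S ^ 2 - (S * x) ^ 2 + c) (-(2 * S ^ 2 * x)) (Ioo (0:ℝ) 1) x := by
    intro x _
    have h1 : HasDerivAt (fun x : ℝ => S * x) S x := by simpa using (hasDerivAt_id x).const_mul S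
    have h2 : HasDerivAt (fun x : ℝ => S ^ 2 - (S * x) ^ 2 + c) (0 - (↑(2:ℕ) * (S * x) ^ (2 - 1) * S) + 0) x :=
      ((hasDerivAt_const x _).sub (h1.pow 2)).add (hasDerivAt_const x c)
    refine h2.hasDerivWithinAt.congr_deriv ?_
    push_cast
    ring
  have hinj : InjOn (fun x : ℝ => S ^ 2 - (S * x) ^ 2 + c) (Ioo (0:ℝ) 1) := by
    intro x hx y hy hxy
    have h : (S * x) ^ 2 = (S * y) ^ 2 := by
      dsimp only at hxy
      linarith
    have hx0 : 0 ≤ S * x := by nlinarith [hx.1]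
    have hy0 : 0 ≤ S * y := by nlinarith [hy.1]
    exact mul_left_cancel₀ hS.ne' ((pow_left_inj₀ hx0 hy0 two_ne_zero).1 h)
  have himage : (fun x : ℝ => S ^ 2 - (S * x) ^ 2 + c) '' Ioo (0:ℝ) 1 = Ioo c (S ^ 2 + c) := by
    ext y
    constructor
    · rintro ⟨x, hx, rfl⟩
      have h1 : 0 < S * x := mul_pos hS hx.1
      have h2 : S * x < S := by nlinarith [hx.2]
      constructor <;> nlinarith
    · intro hy
      have hu : 0 < S ^ 2 + c - y := by linarith [hy.2]
      refine ⟨√(S ^ 2 + c - y) / S, ⟨div_pos (Real.sqrt_pos.2 hu) hS, ?_⟩, ?_⟩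
      · rw [div_lt_one hS, Real.sqrt_lt' hS]
        linarith [hy.1]
      · have h : S * (√(S ^ 2 + c - y) / S) = √(S ^ 2 + c - y) := by field_simp
        dsimp only
        rw [h, Real.sq_sqrt hu.le]
        ring
  have key := integral_image_eq_integral_abs_deriv_smul measurableSet_Ioo hderiv hinj F
  rw [himage] at key
  rw [intervalIntegral.integral_of_le (by nlinarith : c ≤ S ^ 2 + c), integral_Ioc_eq_integral_Ioo, key,
    intervalIntegral.integral_of_le zero_le_one, integral_Ioc_eq_integral_Ioo, ← integral_const_mul]
  refine setIntegral_congr_fun measurableSet_Ioo fun x hx => ?_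
  rw [abs_neg, abs_of_nonneg (by nlinarith [hx.1] : 0 ≤ 2 * S ^ 2 * x), smul_eq_mul]
  ring

/-- **Reduction to `[0, 1]`**: for `0 ≤ S`, `∫_{-1}^{1} (S x)₊ F(x) dx = ∫₀¹ S x F(x) dx` (the flux vanishes on
`[-1, 0]`). [folklore] -/
theorem integral_posPart_mul_eq_integral_Icc {S : ℝ} (hS : 0 ≤ S) {F : ℝ → ℝ}
    (hF : IntervalIntegrable (fun x => max (S * x) 0 * F x) volume (-1) 1) :
    ∫ x in (-1:ℝ)..1, max (S * x) 0 * F x = ∫ x in (0:ℝ)..1, S * x * F x := by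
  have hsub1 : uIcc (-1:ℝ) 0 ⊆ uIcc (-1:ℝ) 1 := uIcc_subset_uIcc (by rw [mem_uIcc]; norm_num) (by rw [mem_uIcc]; norm_num)
  have hsub2 : uIcc (0:ℝ) 1 ⊆ uIcc (-1:ℝ) 1 := uIcc_subset_uIcc (by rw [mem_uIcc]; norm_num) (by rw [mem_uIcc]; norm_num)
  rw [← intervalIntegral.integral_add_adjacent_intervals (hF.mono_set hsub1) (hF.mono_set hsub2)]
  have h1 : ∫ x in (-1:ℝ)..0, max (S * x) 0 * F x = ∫ x in (-1:ℝ)..0, (0:ℝ) := by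
    refine intervalIntegral.integral_congr fun x hx => ?_
    rw [uIcc_of_le (by norm_num)] at hx
    rw [max_eq_right (by nlinarith [hx.2]), zero_mul]
  have h2 : ∫ x in (0:ℝ)..1, max (S * x) 0 * F x = ∫ x in (0:ℝ)..1, S * x * F x := by
    refine intervalIntegral.integral_congr fun x hx => ?_
    rw [uIcc_of_le zero_le_one] at hx
    rw [max_eq_left (by nlinarith [hx.1])]
  rw [h1, h2, intervalIntegral.integral_const, smul_zero, zero_add]

/-! ### The flux shift and the speed shift of one slice -/

/-- `|G(√(S² - (S x)² + t²))| ≤ m (1 + S + |t|)` (`0 ≤ S`, all `x`, `t`). [folklore] -/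
theorem abs_comp_sqrt_slice_le (hm : ∀ t : ℝ, 0 ≤ t → |G t| ≤ m * (1 + t)) {S : ℝ} (hS : 0 ≤ S) (x t : ℝ) :
    |G (√(S ^ 2 - (S * x) ^ 2 + t ^ 2))| ≤ m * (1 + (S + |t|)) :=
  (hm _ (sqrt_nonneg _)).trans (by
    have := nonneg_of_linearGrowth hm
    gcongr
    exact sqrt_sq_sub_sq_add_sq_le hS (S * x) t)

/-- **The flux shift**: `|∫_{-1}^{1} ((S x - t)₊ - (S x)₊) G(√(S² - (S x)² + t²)) dx| ≤ 2 |t| m (1 + S + |t|)`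
(`x ↦ x₊` is `1`-Lipschitz). [folklore] -/
theorem abs_integral_fluxShift_le (hm : ∀ t : ℝ, 0 ≤ t → |G t| ≤ m * (1 + t)) {S : ℝ} (hS : 0 ≤ S) (t : ℝ) :
    |∫ x in (-1:ℝ)..1, (max (S * x - t) 0 - max (S * x) 0) * G (√(S ^ 2 - (S * x) ^ 2 + t ^ 2))| ≤
      2 * (|t| * (m * (1 + (S + |t|)))) := by
  have h := intervalIntegral.norm_integral_le_of_norm_le_const (a := (-1:ℝ)) (b := 1)
    (C := |t| * (m * (1 + (S + |t|))))
    (f := fun x => (max (S * x - t) 0 - max (S * x) 0) * G (√(S ^ 2 - (S * x) ^ 2 + t ^ 2))) fun x _ => by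
      rw [Real.norm_eq_abs, abs_mul]
      refine mul_le_mul ?_ (abs_comp_sqrt_slice_le hm hS x t) (abs_nonneg _) (abs_nonneg _)
      have h := abs_max_sub_max_le_abs (S * x - t) (S * x) 0
      rwa [show S * x - t - S * x = -t by ring, abs_neg] at h
  rw [Real.norm_eq_abs] at h
  refine h.trans (le_of_eq ?_)
  norm_num
  ring

/-- **The speed shift**: for `0 ≤ S` and every `t`,
`|∫_{-1}^{1} (S x)₊ (G(√(S² - (S x)² + t²)) - G(√(S² - (S x)²))) dx| ≤ m (4 + |t| + (3/2) t² + |t|³)`.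
For `S ≥ 1` the substitution `y = S² - (S x)² + t²` exhibits the difference as
`(2S)⁻¹ (∫_{S²}^{S² + t²} - ∫₀^{t²}) G(√y) dy`, two windows of length `t²` on which `|G(√y)| ≤ m(1 + S + |t|)`
resp. `m(1 + |t|)`; for `S ≤ 1` the trivial bound `S m (2 + 2S + |t|)` suffices. No regularity of `G` is
involved. [folklore] -/
theorem abs_integral_speedShift_le (hG : Measurable G) (hm : ∀ t : ℝ, 0 ≤ t → |G t| ≤ m * (1 + t)) {S : ℝ}
    (hS : 0 ≤ S) (t : ℝ) :
    |∫ x in (-1:ℝ)..1, max (S * x) 0 * (G (√(S ^ 2 - (S * x) ^ 2 + t ^ 2)) - G (√(S ^ 2 - (S * x) ^ 2)))| ≤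
      m * (4 + |t| + 3 / 2 * t ^ 2 + |t| ^ 3) := by
  have hm0 := nonneg_of_linearGrowth hm
  have hG0 : ∀ x, |G (√(S ^ 2 - (S * x) ^ 2))| ≤ m * (1 + S) := fun x =>
    (hm _ (sqrt_nonneg _)).trans (by
      gcongr
      rw [Real.sqrt_le_left hS]
      nlinarith [sq_nonneg (S * x)])
  have hdiff : ∀ x, |G (√(S ^ 2 - (S * x) ^ 2 + t ^ 2)) - G (√(S ^ 2 - (S * x) ^ 2))| ≤
      m * (1 + (S + |t|)) + m * (1 + S) := fun x =>
    (abs_sub _ _).trans (add_le_add (abs_comp_sqrt_slice_le hm hS x t) (hG0 x))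
  have hF : IntervalIntegrable (fun x => max (S * x) 0 *
      (G (√(S ^ 2 - (S * x) ^ 2 + t ^ 2)) - G (√(S ^ 2 - (S * x) ^ 2)))) volume (-1) 1 := by
    refine intervalIntegrable_of_abs_le (by fun_prop) (C := S * (m * (1 + (S + |t|)) + m * (1 + S))) fun x hx => ?_
    rw [uIoc_of_le (by norm_num)] at hx
    rw [abs_mul, abs_of_nonneg (le_max_right _ _)]
    refine mul_le_mul (max_le (by nlinarith [hx.2]) hS) (hdiff x) (abs_nonneg _) hS
  rw [integral_posPart_mul_eq_integral_Icc hS hF]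
  -- the trivial bound, used for `S ≤ 1`
  have hcrude : |∫ x in (0:ℝ)..1, S * x * (G (√(S ^ 2 - (S * x) ^ 2 + t ^ 2)) - G (√(S ^ 2 - (S * x) ^ 2)))| ≤
      S * (m * (1 + (S + |t|)) + m * (1 + S)) := by
    have h := intervalIntegral.norm_integral_le_of_norm_le_const (a := (0:ℝ)) (b := 1)
      (C := S * (m * (1 + (S + |t|)) + m * (1 + S)))
      (f := fun x => S * x * (G (√(S ^ 2 - (S * x) ^ 2 + t ^ 2)) - G (√(S ^ 2 - (S * x) ^ 2)))) fun x hx => by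
        rw [uIoc_of_le zero_le_one] at hx
        rw [Real.norm_eq_abs, abs_mul, abs_of_nonneg (by nlinarith [hx.1] : 0 ≤ S * x)]
        exact mul_le_mul (by nlinarith [hx.2]) (hdiff x) (abs_nonneg _) hS
    rw [Real.norm_eq_abs] at h
    simpa using h
  have htail : (0:ℝ) ≤ 3 / 2 * t ^ 2 + |t| ^ 3 := by positivity
  rcases le_total S 1 with hS1 | hS1
  · refine hcrude.trans ?_
    nlinarith [mul_nonneg hm0 (abs_nonneg t), mul_nonneg hm0 (sub_nonneg.2 hS1), mul_nonneg (mul_nonneg hm0 hS) (sub_nonneg.2 hS1),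
      mul_nonneg (mul_nonneg hm0 (abs_nonneg t)) (sub_nonneg.2 hS1)]
  -- `S ≥ 1`: the substitution
  have hS' : 0 < S := by linarith
  have i1 : IntervalIntegrable (fun x => S * x * G (√(S ^ 2 - (S * x) ^ 2 + t ^ 2))) volume 0 1 := by
    refine intervalIntegrable_of_abs_le (by fun_prop) (C := S * (m * (1 + (S + |t|)))) fun x hx => ?_
    rw [uIoc_of_le zero_le_one] at hx
    rw [abs_mul, abs_of_nonneg (by nlinarith [hx.1] : 0 ≤ S * x)]
    exact mul_le_mul (by nlinarith [hx.2]) (abs_comp_sqrt_slice_le hm hS x t) (abs_nonneg _) hS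
  have i2 : IntervalIntegrable (fun x => S * x * G (√(S ^ 2 - (S * x) ^ 2))) volume 0 1 := by
    refine intervalIntegrable_of_abs_le (by fun_prop) (C := S * (m * (1 + S))) fun x hx => ?_
    rw [uIoc_of_le zero_le_one] at hx
    rw [abs_mul, abs_of_nonneg (by nlinarith [hx.1] : 0 ≤ S * x)]
    exact mul_le_mul (by nlinarith [hx.2]) (hG0 x) (abs_nonneg _) hS
  have e1 : ∫ x in (0:ℝ)..1, S * x * G (√(S ^ 2 - (S * x) ^ 2 + t ^ 2)) =
      (2 * S)⁻¹ * ∫ y in (t ^ 2)..(S ^ 2 + t ^ 2), G (√y) := by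
    rw [← integral_mul_comp_slice_subst (fun y => G (√y)) hS' (t ^ 2), ← mul_assoc,
      inv_mul_cancel₀ (by positivity), one_mul]
  have e2 : ∫ x in (0:ℝ)..1, S * x * G (√(S ^ 2 - (S * x) ^ 2)) = (2 * S)⁻¹ * ∫ y in (0:ℝ)..(S ^ 2), G (√y) := by
    have h := integral_mul_comp_slice_subst (fun y => G (√y)) hS' 0
    simp only [add_zero] at h
    rw [← h, ← mul_assoc, inv_mul_cancel₀ (by positivity), one_mul]
  have adj1 := intervalIntegral.integral_add_adjacent_intervals (intervalIntegrable_comp_sqrt hG hm 0 (t ^ 2))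
    (intervalIntegrable_comp_sqrt hG hm (t ^ 2) (S ^ 2 + t ^ 2))
  have adj2 := intervalIntegral.integral_add_adjacent_intervals (intervalIntegrable_comp_sqrt hG hm 0 (S ^ 2))
    (intervalIntegrable_comp_sqrt hG hm (S ^ 2) (S ^ 2 + t ^ 2))
  have hB : ∫ x in (0:ℝ)..1, S * x * (G (√(S ^ 2 - (S * x) ^ 2 + t ^ 2)) - G (√(S ^ 2 - (S * x) ^ 2))) =
      (2 * S)⁻¹ * ((∫ y in (S ^ 2)..(S ^ 2 + t ^ 2), G (√y)) - ∫ y in (0:ℝ)..(t ^ 2), G (√y)) := by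
    simp_rw [mul_sub]
    rw [intervalIntegral.integral_sub i1 i2, e1, e2]
    linear_combination (2 * S)⁻¹ * (adj1 - adj2)
  -- the two windows of length `t²`
  have w1 : |∫ y in (0:ℝ)..(t ^ 2), G (√y)| ≤ m * (1 + |t|) * t ^ 2 := by
    have h := intervalIntegral.norm_integral_le_of_norm_le_const (a := (0:ℝ)) (b := t ^ 2) (C := m * (1 + |t|))
      (f := fun y => G (√y)) fun y hy => by
        rw [uIoc_of_le (sq_nonneg t)] at hy
        rw [Real.norm_eq_abs]
        refine (hm _ (sqrt_nonneg y)).trans ?_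
        gcongr
        rw [← Real.sqrt_sq_eq_abs]
        exact Real.sqrt_le_sqrt hy.2
    rwa [Real.norm_eq_abs, sub_zero, abs_of_nonneg (sq_nonneg t)] at h
  have w2 : |∫ y in (S ^ 2)..(S ^ 2 + t ^ 2), G (√y)| ≤ m * (1 + (S + |t|)) * t ^ 2 := by
    have h := intervalIntegral.norm_integral_le_of_norm_le_const (a := S ^ 2) (b := S ^ 2 + t ^ 2)
      (C := m * (1 + (S + |t|))) (f := fun y => G (√y)) fun y hy => by
        rw [uIoc_of_le (by nlinarith)] at hy
        rw [Real.norm_eq_abs]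
        refine (hm _ (sqrt_nonneg y)).trans ?_
        gcongr
        refine (Real.sqrt_le_sqrt hy.2).trans ?_
        have h0 := sqrt_sq_sub_sq_add_sq_le hS 0 t
        simpa using h0
    rwa [Real.norm_eq_abs, add_sub_cancel_left, abs_of_nonneg (sq_nonneg t)] at h
  rw [hB, abs_mul, abs_of_pos (by positivity : (0:ℝ) < (2 * S)⁻¹)]
  have habs : |(∫ y in (S ^ 2)..(S ^ 2 + t ^ 2), G (√y)) - ∫ y in (0:ℝ)..(t ^ 2), G (√y)| ≤
      m * (1 + (S + |t|)) * t ^ 2 + m * (1 + |t|) * t ^ 2 := (abs_sub _ _).trans (add_le_add w2 w1)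
  calc (2 * S)⁻¹ * |(∫ y in (S ^ 2)..(S ^ 2 + t ^ 2), G (√y)) - ∫ y in (0:ℝ)..(t ^ 2), G (√y)|
      ≤ (2 * S)⁻¹ * (m * (1 + (S + |t|)) * t ^ 2 + m * (1 + |t|) * t ^ 2) :=
        mul_le_mul_of_nonneg_left habs (by positivity)
    _ ≤ m * (3 / 2 * t ^ 2 + |t| ^ 3) := by
        have h3 : |t| ^ 3 = |t| * t ^ 2 := by rw [pow_succ', sq_abs]
        rw [inv_mul_le_iff₀ (by positivity), h3]
        nlinarith [mul_nonneg (mul_nonneg hm0 (sq_nonneg t)) (sub_nonneg.2 hS1),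
          mul_nonneg (mul_nonneg (mul_nonneg hm0 (sq_nonneg t)) (abs_nonneg t)) (sub_nonneg.2 hS1)]
    _ ≤ m * (4 + |t| + 3 / 2 * t ^ 2 + |t| ^ 3) := by
        gcongr
        linarith [abs_nonneg t]

/-! ### The slice comparison and its Gaussian average -/

/-- **The slice comparison, pointwise in the thermal projection**: for `G` measurable with `|G t| ≤ m(1 + t)`
on `[0, ∞)`, `0 ≤ S` and every `t`, `|J(t) - J(0)| ≤ m (4 + (3 + 2S)|t| + (7/2) t² + |t|³)`,
`J(t) = ∫_{-1}^{1} (S x - t)₊ G(√(S² - (S x)² + t²)) dx` (flux shift + speed shift). [folklore] -/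
theorem abs_slice_sub_slice_zero_le (hG : Measurable G) (hm : ∀ t : ℝ, 0 ≤ t → |G t| ≤ m * (1 + t)) {S : ℝ}
    (hS : 0 ≤ S) (t : ℝ) :
    |(∫ x in (-1:ℝ)..1, max (S * x - t) 0 * G (√(S ^ 2 - (S * x) ^ 2 + t ^ 2))) -
        ∫ x in (-1:ℝ)..1, max (S * x) 0 * G (√(S ^ 2 - (S * x) ^ 2))| ≤
      m * (4 + (3 + 2 * S) * |t| + 7 / 2 * t ^ 2 + |t| ^ 3) := by
  have hm0 := nonneg_of_linearGrowth hm
  have hG0 : ∀ x, |G (√(S ^ 2 - (S * x) ^ 2))| ≤ m * (1 + S) := fun x =>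
    (hm _ (sqrt_nonneg _)).trans (by
      gcongr
      rw [Real.sqrt_le_left hS]
      nlinarith [sq_nonneg (S * x)])
  have hpos : ∀ x ∈ uIoc (-1:ℝ) 1, ∀ s : ℝ, max (S * x - s) 0 ≤ S + |s| := fun x hx s => by
    rw [uIoc_of_le (by norm_num)] at hx
    exact max_le (by nlinarith [hx.2, neg_abs_le s]) (by positivity)
  have ik : IntervalIntegrable (fun x => max (S * x - t) 0 * G (√(S ^ 2 - (S * x) ^ 2 + t ^ 2))) volume (-1) 1 := by
    refine intervalIntegrable_of_abs_le (by fun_prop) (C := (S + |t|) * (m * (1 + (S + |t|)))) fun x hx => ?_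
    rw [abs_mul, abs_of_nonneg (le_max_right _ _)]
    exact mul_le_mul (hpos x hx t) (abs_comp_sqrt_slice_le hm hS x t) (abs_nonneg _) (by positivity)
  have ik0 : IntervalIntegrable (fun x => max (S * x) 0 * G (√(S ^ 2 - (S * x) ^ 2))) volume (-1) 1 := by
    refine intervalIntegrable_of_abs_le (by fun_prop) (C := (S + |(0:ℝ)|) * (m * (1 + S))) fun x hx => ?_
    rw [abs_mul, abs_of_nonneg (le_max_right _ _)]
    refine mul_le_mul ?_ (hG0 x) (abs_nonneg _) (by positivity)
    simpa using hpos x hx 0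
  have iP : IntervalIntegrable (fun x => (max (S * x - t) 0 - max (S * x) 0) *
      G (√(S ^ 2 - (S * x) ^ 2 + t ^ 2))) volume (-1) 1 := by
    refine intervalIntegrable_of_abs_le (by fun_prop) (C := |t| * (m * (1 + (S + |t|)))) fun x _ => ?_
    rw [abs_mul]
    refine mul_le_mul ?_ (abs_comp_sqrt_slice_le hm hS x t) (abs_nonneg _) (abs_nonneg _)
    have h := abs_max_sub_max_le_abs (S * x - t) (S * x) 0
    rwa [show S * x - t - S * x = -t by ring, abs_neg] at h
  have iQ : IntervalIntegrable (fun x => max (S * x) 0 *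
      (G (√(S ^ 2 - (S * x) ^ 2 + t ^ 2)) - G (√(S ^ 2 - (S * x) ^ 2)))) volume (-1) 1 := by
    refine intervalIntegrable_of_abs_le (by fun_prop) (C := (S + |(0:ℝ)|) * (m * (1 + (S + |t|)) + m * (1 + S)))
      fun x hx => ?_
    rw [abs_mul, abs_of_nonneg (le_max_right _ _)]
    refine mul_le_mul (by simpa using hpos x hx 0) ?_ (abs_nonneg _) (by positivity)
    exact (abs_sub _ _).trans (add_le_add (abs_comp_sqrt_slice_le hm hS x t) (hG0 x))
  have hsplit : (∫ x in (-1:ℝ)..1, max (S * x - t) 0 * G (√(S ^ 2 - (S * x) ^ 2 + t ^ 2))) -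
        (∫ x in (-1:ℝ)..1, max (S * x) 0 * G (√(S ^ 2 - (S * x) ^ 2))) =
      (∫ x in (-1:ℝ)..1, (max (S * x - t) 0 - max (S * x) 0) * G (√(S ^ 2 - (S * x) ^ 2 + t ^ 2))) +
        ∫ x in (-1:ℝ)..1, max (S * x) 0 * (G (√(S ^ 2 - (S * x) ^ 2 + t ^ 2)) - G (√(S ^ 2 - (S * x) ^ 2))) := by
    rw [← intervalIntegral.integral_sub ik ik0, ← intervalIntegral.integral_add iP iQ]
    refine intervalIntegral.integral_congr fun x _ => ?_
    ring
  rw [hsplit]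
  calc _ ≤ |∫ x in (-1:ℝ)..1, (max (S * x - t) 0 - max (S * x) 0) * G (√(S ^ 2 - (S * x) ^ 2 + t ^ 2))| +
        |∫ x in (-1:ℝ)..1, max (S * x) 0 * (G (√(S ^ 2 - (S * x) ^ 2 + t ^ 2)) - G (√(S ^ 2 - (S * x) ^ 2)))| :=
        abs_add_le _ _
    _ ≤ 2 * (|t| * (m * (1 + (S + |t|)))) + m * (4 + |t| + 3 / 2 * t ^ 2 + |t| ^ 3) :=
        add_le_add (abs_integral_fluxShift_le hm hS t) (abs_integral_speedShift_le hG hm hS t)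
    _ = m * (4 + (3 + 2 * S) * |t| + 7 / 2 * t ^ 2 + |t| ^ 3) := by
        have h2 : |t| * |t| = t ^ 2 := by rw [← sq, sq_abs]
        linear_combination (2 * m) * h2

/-- The polynomial envelope: `4 + (3 + 2S)|t| + (7/2)t² + |t|³ ≤ (11/2 + S)(1 + t²) + t⁴/2` (`0 ≤ S`;
`2|t| ≤ 1 + t²`, `2|t|³ ≤ t² + t⁴`). [folklore] -/
theorem slice_envelope_le {S : ℝ} (hS : 0 ≤ S) (t : ℝ) :
    4 + (3 + 2 * S) * |t| + 7 / 2 * t ^ 2 + |t| ^ 3 ≤ (11 / 2 + S) * (1 + t ^ 2) + t ^ 4 / 2 := by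
  have h2 : t ^ 2 = |t| ^ 2 := (sq_abs t).symm
  have h4 : t ^ 4 = |t| ^ 4 := by rw [show t ^ 4 = (t ^ 2) ^ 2 by ring, h2]; ring
  rw [h2, h4]
  nlinarith [mul_nonneg (by positivity : (0:ℝ) ≤ 3 + 2 * S) (sq_nonneg (1 - |t|)),
    mul_nonneg (sq_nonneg |t|) (sq_nonneg (1 - |t|)), abs_nonneg t]

/-- **The Gaussian moments of the envelope**: `∫ m((11/2 + S)(1 + t²) + t⁴/2) dγ(t) = m (25/2 + 2S)`
(`∫ t² dγ = 1`, `∫ t⁴ dγ = 3`), with its integrability. [folklore] -/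
theorem integral_slice_envelope (m S : ℝ) :
    Integrable (fun t : ℝ => m * ((11 / 2 + S) * (1 + t ^ 2) + t ^ 4 / 2)) (gaussianReal 0 1) ∧
      ∫ t, m * ((11 / 2 + S) * (1 + t ^ 2) + t ^ 4 / 2) ∂gaussianReal 0 1 = m * (25 / 2 + 2 * S) := by
  have i2 : Integrable (fun t : ℝ => t ^ 2) (gaussianReal 0 1) := integrable_pow_gaussianReal 0 1 2
  have i4 : Integrable (fun t : ℝ => t ^ 4) (gaussianReal 0 1) := integrable_pow_gaussianReal 0 1 4
  have v2 : ∫ t : ℝ, t ^ 2 ∂gaussianReal 0 1 = 1 := by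
    have h := integral_pow_even_gaussianReal_one 1
    norm_num [Nat.doubleFactorial] at h
    exact h
  have v4 : ∫ t : ℝ, t ^ 4 ∂gaussianReal 0 1 = 3 := by
    have h := integral_pow_even_gaussianReal_one 2
    norm_num [Nat.doubleFactorial] at h
    exact h
  have ia : Integrable (fun t : ℝ => (11 / 2 + S) * (1 + t ^ 2)) (gaussianReal 0 1) :=
    ((integrable_const _).add i2).const_mul _
  have ib : Integrable (fun t : ℝ => t ^ 4 / 2) (gaussianReal 0 1) := i4.div_const _
  refine ⟨(ia.add ib).const_mul m, ?_⟩
  rw [integral_const_mul, integral_add ia ib, integral_const_mul, integral_add (integrable_const _) i2,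
    integral_div, integral_const, v2, v4, probReal_univ, one_smul]
  ring

/-- **(e-K₂) on general radial test functions**: for `G : ℝ → ℝ` measurable with `|G t| ≤ m (1 + t)` on `[0, ∞)`
and every `v ∈ ℝ³`, `|gainTerm (G ∘ ‖·‖) v - lorentzGain (G ∘ ‖·‖) v| ≤ 2π m (25 + 4‖v‖)` — the slice form
`4π ∫ γ(dt) (J(t) - J(0))`, the pointwise slice comparison and the Gaussian moments of its envelope. [folklore] -/
theorem abs_gainTerm_radial_sub_lorentzGain_le (hG : Measurable G) (hm : ∀ t : ℝ, 0 ≤ t → |G t| ≤ m * (1 + t))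
    (v : EuclideanSpace ℝ (Fin 3)) :
    |gainTerm (fun x => G ‖x‖) v - lorentzGain (fun x => G ‖x‖) v| ≤ 2 * π * m * (25 + 4 * ‖v‖) := by
  obtain ⟨hg, hgi⟩ := integral_slice_envelope m ‖v‖
  have hpt : ∀ t, |(∫ x in (-1:ℝ)..1, max (‖v‖ * x - t) 0 * G (√(‖v‖ ^ 2 - (‖v‖ * x) ^ 2 + t ^ 2))) - ∫ x in (-1:ℝ)..1, max (‖v‖ * x) 0 * G (√(‖v‖ ^ 2 - (‖v‖ * x) ^ 2))| ≤
      m * ((11 / 2 + ‖v‖) * (1 + t ^ 2) + t ^ 4 / 2) :=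
    fun t => (abs_slice_sub_slice_zero_le hG hm (norm_nonneg v) t).trans
      (mul_le_mul_of_nonneg_left (slice_envelope_le (norm_nonneg v) t) (nonneg_of_linearGrowth hm))
  rw [gainTerm_sub_lorentzGain_radial_eq hG hm v, abs_mul, abs_of_pos (by positivity : (0:ℝ) < 4 * π)]
  calc 4 * π * |∫ t, ((∫ x in (-1:ℝ)..1, max (‖v‖ * x - t) 0 * G (√(‖v‖ ^ 2 - (‖v‖ * x) ^ 2 + t ^ 2))) -
        ∫ x in (-1:ℝ)..1, max (‖v‖ * x) 0 * G (√(‖v‖ ^ 2 - (‖v‖ * x) ^ 2))) ∂gaussianReal 0 1|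
      ≤ 4 * π * ∫ t, m * ((11 / 2 + ‖v‖) * (1 + t ^ 2) + t ^ 4 / 2) ∂gaussianReal 0 1 := by
        refine mul_le_mul_of_nonneg_left ?_ (by positivity)
        rw [← Real.norm_eq_abs]
        exact norm_integral_le_of_norm_le hg (Eventually.of_forall fun t => by rw [Real.norm_eq_abs]; exact hpt t)
    _ = 2 * π * m * (25 + 4 * ‖v‖) := by rw [hgi]; ring

/-! ### Registered helper -/

/-- **Registered helper `t12_gainTerm_radial_sub_lorentz` — (e-K₂) for GENERAL radial test functions: the
true gain term of the linearised hard-sphere operator on `G ∘ ‖·‖` against its far-field (Lorentz) limit, for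
`G` merely measurable of linear growth.** For `G : ℝ → ℝ` measurable with `|G t| ≤ m (1 + t)` for `t ≥ 0`
(no continuity, no bounded variation) and every `v ∈ ℝ³` (`M = stdGaussian`, `σ` the surface measure of `S²`,
`(v', w') = collide ω (v, w)`, `E_v = Lambert.embed (‖v‖⁻¹ v)`, `p ∈ ℝ²` Lebesgue on the unit disc):
`|∫ dM(w) ∫_{S²} ((v-w)·ω)₊ G(‖v'‖) dσ + ∫ dM(w) ∫_{S²} ((v-w)·ω)₊ G(‖w'‖) dσ`
` - ‖v‖ (∫_{‖p‖<1} G(‖‖p‖² v - ‖v‖√(1-‖p‖²) E_v p‖) dp + ∫_{‖p‖<1} G(‖(1-‖p‖²) v + ‖v‖√(1-‖p‖²) E_v p‖) dp)| ≤ 2π m (25 + 4‖v‖)`,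
i.e. `|gainTerm (G ∘ ‖·‖) v - lorentzGain (G ∘ ‖·‖) v| ≤ 2π m (25 + 4‖v‖)` — ABSOLUTE error `O(m(1 + ‖v‖))`,
RELATIVE error `O(1/‖v‖)` against the main term `lorentzGain (G ∘ ‖·‖) v = π‖v‖ · 2∫₀¹ 2ρ G(ρ‖v‖) dρ ≍ m‖v‖²`,
the order consumed by (e-K₂) of the corrector-growth plan. Mechanism (`…T12GainRadialGeneral`): exchange
symmetry + Carleman's slice + Gaussian projection + hat-box give `gainTerm - lorentzGain = 4π ∫ γ(dt)(J(t) - J(0))`,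
`J(t) = ∫_{-1}^{1} (Sx - t)₊ G(√(S² - (Sx)² + t²)) dx`, `γ = N(0,1)`, `S = ‖v‖`; then the flux shift
`|(Sx - t)₊ - (Sx)₊| ≤ |t|` and the speed shift — the substitution `y = S² - (Sx)² + t²` turns
`∫₀¹ Sx G(√(S²(1-x²) + t²)) dx` into `(2S)⁻¹ ∫_{t²}^{S²+t²} G(√y) dy`, an `O(t²)`-DISPLACEMENT of the window
`[0, S²]` (a total-variation, not a Kolmogorov, comparison of the two speed laws) — give
`|J(t) - J(0)| ≤ m(4 + (3 + 2S)|t| + (7/2)t² + |t|³)`, and `∫ t² dγ = 1`, `∫ t⁴ dγ = 3`. Supersedes the indicator,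
step-function and radial-weight cases (`t12_gainTerm_indicator_sub_lorentz`, `t12_gainTerm_norm_sub_lorentz`).
[folklore] -/
theorem t12_gainTerm_radial_sub_lorentz : ∀ (G : ℝ → ℝ) (m : ℝ), Measurable G → (∀ t : ℝ, 0 ≤ t → |G t| ≤ m * (1 + t)) → ∀ v : EuclideanSpace ℝ (Fin 3), |(∫ w, ∫ ω, Literature.MathematicalPhysics.KineticTheory.hardSphereKernel (v, w) ω * G ‖(Literature.MathematicalPhysics.KineticTheory.collide ω (v, w)).1‖ ∂Literature.MathematicalPhysics.KineticTheory.sphereMeasure ∂ProbabilityTheory.stdGaussian (EuclideanSpace ℝ (Fin 3))) + (∫ w, ∫ ω, Literature.MathematicalPhysics.KineticTheory.hardSphereKernel (v, w) ω * G ‖(Literature.MathematicalPhysics.KineticTheory.collide ω (v, w)).2‖ ∂Literature.MathematicalPhysics.KineticTheory.sphereMeasure ∂ProbabilityTheory.stdGaussian (EuclideanSpace ℝ (Fin 3))) - ‖v‖ * ((∫ p in Metric.ball (0 : EuclideanSpace ℝ (Fin 2)) 1, G ‖(‖p‖ ^ 2) • v - (‖v‖ * Real.sqrt (1 - ‖p‖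 ^ 2)) • Literature.Analysis.FluidPDE.Lambert.embed (‖v‖⁻¹ • v) p‖) + ∫ p in Metric.ball (0 : EuclideanSpace ℝ (Fin 2)) 1, G ‖(1 - ‖p‖ ^ 2) • v + (‖v‖ * Real.sqrt (1 - ‖p‖ ^ 2)) • Literature.Analysis.FluidPDE.Lambert.embed (‖v‖⁻¹ • v) p‖)| ≤ 2 * Real.pi * m * (25 + 4 * ‖v‖) :=
  fun _ _ hG hm v => abs_gainTerm_radial_sub_lorentzGain_le hG hm v

end Summit.AtomisticToContinuum.HydrodynamicLimit.Theorems.ClampedCorrectorBirth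

end
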